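import Literature.MathematicalPhysics.QuantumLattice.FermionRelabelling
import Literature.MathematicalPhysics.QuantumLattice.HubbardFermiLiquidProofs
import HarnessLib

/-!
# The finite-volume two-point function of `bgm_two_point_limit` is real

Sibling proof file of `HubbardFermiLiquid.lean` (named fact `bgm_two_point_limit`,
Benfatto–Giuliani–Mastropietro 2006, Thm. 1.1). BGM list among the symmetries of the model (§2.1,
(4) parity and (5) complex conjugation) the ones forcing the renormalised parameters `Z(θ)`,
`v_F(θ)`, `p_F(θ)` of Thm. 1.1 to be REAL. At the level of the finite-volume Gibbs state with
periodic boundary conditions the corresponding statement is that the equal-time two-point function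
`⟨c†_{xσ} c_{yσ'}⟩_{β,L}` (`hubbardThermalTwoPoint`) is a real number. PROVED here from:
the Gibbs state of a Hermitian Hamiltonian is Hermitian (`Matrix.gibbsState_conjTranspose`:
`⟨Aᴴ⟩ = conj ⟨A⟩`, with `(c†_{xσ} c_{yσ'})ᴴ = c†_{yσ'} c_{xσ}`), the symmetry of the torus two-point
function in its two sites (`hubbardThermalTwoPoint_swap_sites`, translation by `-(x+y)` composed
with parity, `FermionRelabelling.lean`), and the spin selection rule
(`hubbardThermalTwoPoint_eq_zero_of_ne`, `HubbardFermiLiquidProofs.lean`):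

* `star_thermalCorr_creation_annihilation` — `conj ⟨c†_{uσ} c_{vσ'}⟩ = ⟨c†_{vσ'} c_{uσ}⟩` on any
  finite graph;
* `star_hubbardThermalTwoPoint`, `hubbardThermalTwoPoint_im` — `conj ⟨c†_{xσ} c_{yσ'}⟩_{β,L} =
  ⟨c†_{xσ} c_{yσ'}⟩_{β,L}`, i.e. the two-point function of the fact is real, for all parameters;
* `im_eq_zero_of_tendsto_hubbardThermalTwoPoint` — hence every limit `S` as in the conclusion of
  the fact is real.

No definition, no named fact.

## References

* G. Benfatto, A. Giuliani, V. Mastropietro, Ann. Henri Poincaré 7 (2006) 809–898, §2.1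
  (symmetries (4) parity, (5) complex conjugation) and Thm. 1.1 ("with Z(θ), v_F(θ) and p_F(θ)
  real"). [BenfattoGiulianiMastropietro2006]
* O. Bratteli, D. W. Robinson, *Operator Algebras and QSM II*, §5.3.1 (Gibbs states are
  Hermitian functionals). [BratteliRobinsonII1997]
-/

noncomputable section

namespace Literature.MathematicalPhysics.QuantumLattice

open Filter Matrix Literature.Probability.LatticeModels HubbardWave0
open scoped _root_.Topology ComplexConjugate

section Graph

variable {Λ : Type*} [LinearOrder Λ] [Fintype Λ] (G : SimpleGraph Λ) [DecidableRel G.Adj]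

/-- `(c†_i c_j)ᴴ = c†_j c_i` (a private copy of the lemma of the same name in
`MagneticHubbardTorus.lean`, not imported here). [folklore] -/
private theorem conjTranspose_creation_mul_annihilation' {ι : Type*} [LinearOrder ι] [Fintype ι] (i j : ι) :
    (creation i * annihilation j)ᴴ = creation j * annihilation i := by
  rw [conjTranspose_mul, creation, creation, conjTranspose_conjTranspose]

/-- **The Gibbs state is Hermitian on hopping monomials**: `conj ⟨c†_{uσ} c_{vσ'}⟩ = ⟨c†_{vσ'} c_{uσ}⟩`
in the Gibbs state of the grand-canonical Hubbard Hamiltonian of any finite graph (real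
parameters). [cite: BratteliRobinsonII1997, §5.3.1] -/
theorem star_thermalCorr_creation_annihilation (β t U μ : ℝ) (u v : Λ) (σ σ' : Fin 2) :
    star (Matrix.thermalCorr β (hamiltonianWith G t U μ) (creation (orb u σ)) (annihilation (orb v σ'))) =
      Matrix.thermalCorr β (hamiltonianWith G t U μ) (creation (orb v σ')) (annihilation (orb u σ)) := by
  rw [Matrix.thermalCorr, Matrix.thermalCorr, ← Matrix.gibbsState_conjTranspose β (isHermitian_hamiltonianWith G t U μ),
    conjTranspose_creation_mul_annihilation']

end Graph

/-- Conjugation exchanges the two sites and spins of the torus two-point function: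
`conj ⟨c†_{xσ} c_{yσ'}⟩_{β,L} = ⟨c†_{yσ'} c_{xσ}⟩_{β,L}`. [cite: BratteliRobinsonII1997, §5.3.1] -/
theorem star_hubbardThermalTwoPoint_eq_swap (β U μ : ℝ) (L : ℕ) (x y : Site 2) (σ σ' : Fin 2) :
    star (hubbardThermalTwoPoint β U μ L x y σ σ') = hubbardThermalTwoPoint β U μ L y x σ' σ := by
  unfold hubbardThermalTwoPoint
  split_ifs with hL
  · exact star_zero _
  · haveI : NeZero L := ⟨hL⟩
    -- proved directly at the torus type (the generic graph lemma above would need a `convert`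
    -- because of syntactically different instance terms inside `hubbardThermalTwoPoint`)
    have hH : (hubbardTorusWith 2 L 1 U μ).IsHermitian := isHermitian_hamiltonianWith (fermionTorusGraph 2 L) 1 U μ
    rw [Matrix.thermalCorr, Matrix.thermalCorr, ← Matrix.gibbsState_conjTranspose β hH,
      conjTranspose_creation_mul_annihilation']

/-- **The two-point function of the fact `bgm_two_point_limit` is real**:
`conj ⟨c†_{xσ} c_{yσ'}⟩_{β,L} = ⟨c†_{xσ} c_{yσ'}⟩_{β,L}` for all `β, U, μ, L, x, y, σ, σ'` (the
spin-off-diagonal components vanish; the diagonal ones are symmetric in the sites by translation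
invariance and parity). [cite: BenfattoGiulianiMastropietro2006, §2.1 (symmetries (4), (5))] -/
theorem star_hubbardThermalTwoPoint (β U μ : ℝ) (L : ℕ) (x y : Site 2) (σ σ' : Fin 2) :
    star (hubbardThermalTwoPoint β U μ L x y σ σ') = hubbardThermalTwoPoint β U μ L x y σ σ' := by
  by_cases hσ : σ = σ'
  · subst hσ
    rw [star_hubbardThermalTwoPoint_eq_swap, hubbardThermalTwoPoint_swap_sites]
  · rw [hubbardThermalTwoPoint_eq_zero_of_ne β U μ L x y hσ, star_zero]

/-- Equivalently: the imaginary part of the two-point function vanishes. [cite: BenfattoGiulianiMastropietro2006, §2.1 (symmetries (4), (5))] -/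
theorem hubbardThermalTwoPoint_im (β U μ : ℝ) (L : ℕ) (x y : Site 2) (σ σ' : Fin 2) :
    (hubbardThermalTwoPoint β U μ L x y σ σ').im = 0 := by
  have h := star_hubbardThermalTwoPoint β U μ L x y σ σ'
  rw [Complex.star_def] at h
  exact Complex.conj_eq_iff_im.1 h

/-- **Hence the limits in the fact are real**: if `⟨c†_{xσ} c_{yσ'}⟩_{β,L} → S` as `L → ∞` then
`Im S = 0`. [cite: BenfattoGiulianiMastropietro2006, Thm. 1.1 ("with Z(θ), v_F(θ) and p_F(θ) real")] -/
theorem im_eq_zero_of_tendsto_hubbardThermalTwoPoint {β U μ : ℝ} {x y : Site 2} {σ σ' : Fin 2} {S : ℂ}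
    (h : Tendsto (fun L : ℕ => hubbardThermalTwoPoint β U μ L x y σ σ') atTop (𝓝 S)) : S.im = 0 := by
  have him : Tendsto (fun L : ℕ => (hubbardThermalTwoPoint β U μ L x y σ σ').im) atTop (𝓝 S.im) :=
    (Complex.continuous_im.tendsto S).comp h
  simp only [hubbardThermalTwoPoint_im] at him
  exact (tendsto_const_nhds_iff.1 him).symm

end Literature.MathematicalPhysics.QuantumLattice

end
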